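import Literature.IUT.LogThetaLattice.StripFrameOfKitsFullness
import Literature.IUT.HodgeArakelov.RealifiedPrimeStripSplitMuLift
import Mathlib.CategoryTheory.Products.Basic

/-!
# `TimesMuSide.ofPassages`: the [IUTchII] Def 4.9 input of `StripFrame.ofKits` INSTANTIATED from the print-level strip groupoids

Mochizuki, *Inter-universal Teichmüller Theory II*, kurims manuscript (Dec 2020), Def 4.9 (vi)–(viii)
pp. 157–158, Cor 4.10 (iv) p. 160; *III* (May 2020), Def 1.1 p. 23, Thm 1.5 (ii) p. 48, Thm 2.2 (i) p. 65;
*I* (May 2020), Def 4.1 (iii)(iv) p. 96, Def 5.2 (ii)(iv) pp. 134–135, Rmk 5.2.1 (i)(ii) p. 143.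
([IUTchII] Def 4.9 (vii) p.158) [claim: Mochizuki2012, status: disputed]. MERGE-MAP plan/L6/MERGE-MAP.md row 46 /
§8 B10 (the last un-owned junction of the real frame); GAP-LEDGER D-G-w4d028-1 ("residual NARROWED to: a
`TimesMuSide` INSTANCE from these print-level groupoids"); DESIGN NOTE W4D028-N2 (base-moving isomorphisms).
Consumer seat abc-iut-L6-t3 (gen 4). Nothing of the series is asserted; typed ≠ discharged.

`StripFrame.ofKits L hbij hsurj hR X` (`StripFrameOfKits`, this seat) assembles the [IUTchIII] §1–§2 frame from the
[IUTchI] kits of abc-iut-L5-t4 and ONE input `X : TimesMuSide FK L` — the categories of `F^{⊢×μ}`-, `F^{⊢▶×μ}`-,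
`F^{⊩▶×μ}`-prime-strips [IUTchII, Def 4.9 (vii)/(viii)] with their functors. This file BUILDS that input from
abc-iut-L6-t2's landed print-level groupoids (`FTimesMuPrimeStrip`, `FSplitTriMuPrimeStrip`,
`FVdashSplitTriMuPrimeStrip`, `toTimesMuFunctor`, `toSplitStripFunctor`), leaving as the one explicit input the two
CROSS-KIT PASSAGES `F^⊢ ↦ F^{⊢×μ}` [Def 4.9 (vi)(vii)] and `F^⊩ ↦ F^{⊩▶×μ}` [Def 4.9 (viii)] from abc-iut-L5-t4's ABSTRACT
ambient categories to abc-iut-L6-t2's records (`TimesMuPassages`: the kit's `FmAmb v` is abstract, so the `×μ`-Kummer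
data of an `ℱ^⊢`-prime-strip cannot be read off it; no landed module owns them; TODO-merge abc-iut-L6-t2 / abc-iut-L5).

SHAPE (DESIGN NOTE W4D028-N2 of abc-iut-w4-d028, "minimal" option). abc-iut-L6-t2's local data are typed over a
FIXED group `G_v`, their morphisms (`MuIso`, `SplitIso`) lie OVER THE IDENTITY of the base, whereas print's
isomorphisms of `F^{⊢×μ}`-prime-strips [Def 4.9 (vii): "collections of isomorphisms … between the various constituent
objects", split-`×μ`-Kummer FROBENIOIDS over bases `‡𝒟^⊢_v`] MOVE THE BASE, and the kit's `ℱ^⊢ ↦ 𝒟^⊢` reaches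
base-moving isomorphisms (`hsurj` = [IUTchI] Cor 5.3 (iii)). Hence an `F^{⊢×μ}`-prime-strip of the assembled frame
is the PAIR (its `𝒟^⊢`-prime-strip in the kit, its `×μ`-Kummer data in abc-iut-L6-t2's groupoid), a morphism a pair
(`𝒟^⊢`-isomorphism `β`, `×μ`-isomorphism `m`), `F^{⊢×μ} ↦ D^⊢` the first projection (Mathlib's product category).
DISCLOSED: print couples the components (`m` is `β`-semilinear along the group isomorphism underlying `β`); that
coupling is not expressible over the present kits (abc-iut-L6-t2's `G_v` is not read off the kit's `‡𝒟^⊢_v`) and is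
NOT modelled. abc-iut-w4-d028's frame-level theorems (`StripFrameOfKitsFullness`) need only iso-surjectivity of
`F^{⊩▶×μ} ↦ F^{⊢×μ}`, which the product shape keeps.

CONNECTEDNESS WITHOUT A KIT RULE. abc-iut-L6-t2's record types carry no "isomorphic to the model" field, so "any
two strips are isomorphic" is FALSE on the full record types (their `iso_nonempty_of_model` takes it as a
hypothesis). Print [Def 4.9 (vii)/(viii)]: an `F^{⊢▶×μ}`-prime-strip "is a collection of data that is isomorphic to
`‡F^{⊢▶×μ}_v`". So every strip category here is the full sub-groupoid `Isomorphs M₀` of objects ISOMORPHIC TO THE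
MODEL (as abc-iut-L5-t4's `FStrip.isModel`), on which connectedness is a THEOREM (`Isomorphs.iso_nonempty`); the
`𝒟^⊢`-prime-strips are the isomorphs, in the kit's abstract groupoid `M.DMono`, of the `𝒟^⊢`-prime-strip of the
model `ℱ^⊢`-prime-strip [IUTchI, Def 4.1 (iii): "admits an equivalence `†𝒟^⊢_v ⥲ 𝒟^⊢_v`"].

CONSEQUENCES (§ 4). For `X := TimesMuSide.ofPassages L hR Ps` the ONE hypothesis of `StripFrameOfKitsFullness` —
iso-surjectivity of `F^{⊩▶×μ} ↦ F^{⊢▶×μ} ↦ F^{⊢×μ}` — is a THEOREM (`TimesMuSide.ofPassages_mapIso_surjective`, from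
abc-iut-w4-d028's print-level lift `FVdashSplitTriMuPrimeStrip.mapIso_toTimesMu_surjective_of_iso`), so on the real
frame over these groupoids the residual `R` [IUTchII Cor 4.10 (iv) "coincides with the full poly-isomorphism"],
`UnitMuCoric` (FACT-LIST F-2065), [IUTchIII] Thm 2.2 (i) `mapAut_surjective` and Thm 1.5 (ii) `induced_full` hold with
NO hypothesis on the [IUTchII] side (`hbij`/`hsurj`/`hR` = [IUTchI] Cor 5.3 (ii)(iii), Rmk 5.2.1 (ii) remain the kit's
named hypotheses). § 5: the input `TimesMuPassages` is jointly satisfiable (constant passages — consistency only).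
UNIVERSES: the kit's index of places is small (`K.V : Type`), so abc-iut-L6-t2's records over `V := K.V` are taken at
universes `(0, v, w)` (`G_v : Type`, `O^▷ : CommMonCat.{v}`) and live in `Type (max (v+1) w)`; the single-universe kit
is taken there (`K : PMBaseKit.{max (v+1) w} l`; `v = w = 0`: a universe-`1` kit, MERGE-MAP v16 CC5).
-/

namespace Literature.IUT.LogThetaLattice

open CategoryTheory
open Literature.IUT.HodgeTheaters Literature.IUT.HodgeTheaters.PMBaseKit
open Literature.IUT.HodgeArakelov

universe v₁ v₂ v₃ u₁ u₂ u₃ u' v w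

/-! ### 1. Isomorphs of a model object (the "is isomorphic to `‡F_v`" clause as a sub-groupoid) -/

section Isomorphs

variable {C : Type u₁} [Category.{v₁} C]

/-- **IUTchII:Def4.9(vii)** (kurims p.158) The objects of an ambient category `C` "isomorphic to" a MODEL object `M₀` —
the defining clause of every kind of prime-strip ([IUTchII] Def 4.9 (vii) p.158 "a collection of data … that is
isomorphic to `‡F^{⊢▶×μ}_v`"; [IUTchI] Def 5.2 (i)(ii) p.134, Def 4.1 (iii) p.96); morphisms are those of `C`
(full subcategory). ([IUTchII] Def 4.9 (vii) p.158) [claim: Mochizuki2012, status: disputed] -/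
structure Isomorphs (M₀ : C) : Type u₁ where
  /-- the underlying object of `C` -/
  obj : C
  /-- "isomorphic to" the model -/
  isModel : Nonempty (obj ≅ M₀)

namespace Isomorphs

variable {M₀ : C}

/-- **IUTchII:Def4.9(vii)** (kurims p.158) Morphisms of isomorphs of the model are the morphisms of the ambient category
("collections of isomorphisms … between the various constituent objects"). ([IUTchII] Def 4.9 (vii) p.158)
[claim: Mochizuki2012, status: disputed] -/
instance category : Category.{v₁} (Isomorphs M₀) where
  Hom A B := A.obj ⟶ B.obj
  id A := 𝟙 A.obj
  comp f g := f ≫ g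
  id_comp f := Category.id_comp f
  comp_id f := Category.comp_id f
  assoc f g h := Category.assoc f g h

/-- **IUTchII:Def4.9(vii)** (kurims p.158) An isomorphism of underlying objects IS an isomorphism of isomorphs.
([IUTchII] Def 4.9 (vii) p.158) [claim: Mochizuki2012, status: disputed] -/
def isoMk {A B : Isomorphs M₀} (e : A.obj ≅ B.obj) : A ≅ B where
  hom := e.hom
  inv := e.inv
  hom_inv_id := e.hom_inv_id
  inv_hom_id := e.inv_hom_id

/-- **IUTchII:Def4.9(vii)** (kurims p.158) Isomorphs of a model in a groupoid form a groupoid ("morphisms = isomorphisms").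
([IUTchII] Def 4.9 (vii) p.158) [claim: Mochizuki2012, status: disputed] -/
instance isGroupoid [IsGroupoid C] : IsGroupoid (Isomorphs M₀) where
  all_isIso {A B} f :=
    let f' : A.obj ⟶ B.obj := f
    (isoMk (asIso f')).isIso_hom

variable (M₀) in
/-- **IUTchII:Def4.9(vii)** (kurims p.158) The model object is an isomorph of itself (`‡F` is a prime-strip).
([IUTchII] Def 4.9 (vii) p.158) [claim: Mochizuki2012, status: disputed] -/
def model : Isomorphs M₀ := ⟨M₀, ⟨Iso.refl M₀⟩⟩

variable (M₀) in
/-- **IUTchII:Def4.9(vii)** (kurims p.158) The inclusion of the isomorphs of the model into the ambient category.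
([IUTchII] Def 4.9 (vii) p.158) [claim: Mochizuki2012, status: disputed] -/
def ι : Isomorphs M₀ ⥤ C where
  obj A := A.obj
  map f := f

/-- **IUTchII:Def4.9(vii)** (kurims p.158) `ι` on objects. ([IUTchII] Def 4.9 (vii) p.158) [claim: Mochizuki2012, status: disputed] -/
@[simp] theorem ι_obj (A : Isomorphs M₀) : (ι M₀).obj A = A.obj := rfl

/-- **IUTchII:Def4.9(vii)** (kurims p.158) `ι` on morphisms. ([IUTchII] Def 4.9 (vii) p.158) [claim: Mochizuki2012, status: disputed] -/
@[simp] theorem ι_map {A B : Isomorphs M₀} (f : A ⟶ B) : (ι M₀).map f = f := rfl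

/-- **IUTchII:Def4.9(vii)** (kurims p.158) Isomorphisms of isomorphs correspond exactly to isomorphisms of the underlying
objects. ([IUTchII] Def 4.9 (vii) p.158) [claim: Mochizuki2012, status: disputed] -/
def isoEquiv (A B : Isomorphs M₀) : (A ≅ B) ≃ (A.obj ≅ B.obj) where
  toFun e := (ι M₀).mapIso e
  invFun e := isoMk e
  left_inv _ := Iso.ext rfl
  right_inv _ := Iso.ext rfl

/-- **IUTchII:Def4.9(vii)** (kurims p.158) CONNECTEDNESS, PROVED: any two isomorphs of the model are isomorphic (both are
isomorphic to the model) — the `StripFrame.iso_nonempty_*` field shape, here a theorem and not a kit rule.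
([IUTchII] Def 4.9 (vii) p.158) [claim: Mochizuki2012, status: disputed] -/
theorem iso_nonempty (A B : Isomorphs M₀) : Nonempty (A ≅ B) :=
  ⟨isoMk (A.isModel.some ≪≫ B.isModel.some.symm)⟩

variable {B : Type u₂} [Category.{v₂} B] {D : Type u₃} [Category.{v₃} D]

/-- **IUTchII:Def4.9(vii)** (kurims p.158) A functor whose values are isomorphic to the model LIFTS to the isomorphs of the
model ("a functorial algorithm … whose output is a prime-strip"). ([IUTchII] Def 4.9 (vii) p.158)
[claim: Mochizuki2012, status: disputed] -/
def lift (Φ : B ⥤ C) (h : ∀ b : B, Nonempty (Φ.obj b ≅ M₀)) : B ⥤ Isomorphs M₀ where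
  obj b := ⟨Φ.obj b, h b⟩
  map f := Φ.map f
  map_id b := Φ.map_id b
  map_comp f g := Φ.map_comp f g

/-- **IUTchII:Def4.9(vii)** (kurims p.158) `lift` on objects. ([IUTchII] Def 4.9 (vii) p.158) [claim: Mochizuki2012, status: disputed] -/
@[simp] theorem lift_obj_obj (Φ : B ⥤ C) (h : ∀ b : B, Nonempty (Φ.obj b ≅ M₀)) (b : B) :
    ((lift Φ h).obj b).obj = Φ.obj b := rfl

/-- **IUTchII:Def4.9(vii)** (kurims p.158) `lift` on morphisms. ([IUTchII] Def 4.9 (vii) p.158) [claim: Mochizuki2012, status: disputed] -/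
@[simp] theorem lift_map (Φ : B ⥤ C) (h : ∀ b : B, Nonempty (Φ.obj b ≅ M₀)) {b b' : B} (f : b ⟶ b') :
    (lift Φ h).map f = Φ.map f := rfl

/-- **IUTchII:Def4.9(vii)** (kurims p.158) A functor of ambient categories carries isomorphs of `M₀` to isomorphs of its image
`F M₀` ("passing to `×μ`", "forgetting to the `F^{⊢▶×μ}`-prime-strip" preserve "isomorphic to the model").
([IUTchII] Def 4.9 (vii) p.158) [claim: Mochizuki2012, status: disputed] -/
def mapAlong (F : C ⥤ D) : Isomorphs M₀ ⥤ Isomorphs (F.obj M₀) :=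
  lift (ι M₀ ⋙ F) fun A => ⟨F.mapIso A.isModel.some⟩

/-- **IUTchII:Def4.9(vii)** (kurims p.158) `mapAlong` on objects. ([IUTchII] Def 4.9 (vii) p.158) [claim: Mochizuki2012, status: disputed] -/
@[simp] theorem mapAlong_obj_obj (F : C ⥤ D) (A : Isomorphs M₀) : ((mapAlong F).obj A).obj = F.obj A.obj := rfl

/-- **IUTchII:Def4.9(vii)** (kurims p.158) `mapAlong` on morphisms. ([IUTchII] Def 4.9 (vii) p.158) [claim: Mochizuki2012, status: disputed] -/
@[simp] theorem mapAlong_map (F : C ⥤ D) {A A' : Isomorphs M₀} (f : A ⟶ A') :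
    (mapAlong F).map f = F.map (f : A.obj ⟶ A'.obj) := rfl

end Isomorphs

end Isomorphs

/-! ### 2. `𝒟^⊢`-prime-strips underlying `ℱ^⊢`-prime-strips, inside the kit's abstract groupoid `M.DMono` -/

section DMono

variable {l : ℕ} {K : PMBaseKit.{u'} l} {M : K.MultKit}

variable (M) in
/-- **IUTchI:Def5.2(ii)** (kurims p.134) The MODEL `ℱ^⊢`-prime-strip `𝔉^⊢ = {ℱ^⊢_v}_{v∈𝕍}` of abc-iut-L5-t4's kit (each constituent the model
`ℱ^⊢_v`, "as in Examples 3.2, (v); 3.3, (i); 3.4, (ii)"). ([IUTchI] Def 5.2 (ii) p.134) [claim: Mochizuki2012, status: disputed] -/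
def modelFmStrip (FK : K.FKit M) : FK.FmStrip := ⟨FK.fmModel, fun _ => ⟨Iso.refl _⟩⟩

variable {FK : K.FKit M}

variable (FK) in
/-- **IUTchI:Def4.1(iii)** (kurims p.96) The `𝒟^⊢`-prime-strips OF `ℱ`-TYPE: the objects of abc-iut-L5-t4's abstract groupoid `M.DMono` of
`𝒟^⊢`-prime-strips that are isomorphic to the `𝒟^⊢`-prime-strip of the model `ℱ^⊢`-prime-strip [Rmk 5.2.1 (i):
`𝔉^⊢ ↦ 𝔇^⊢`] — print's "`†𝔇^⊢ = {†𝒟^⊢_v}` … admits an equivalence `†𝒟^⊢_v ⥲ 𝒟^⊢_v`" (so ALL `𝒟^⊢`-prime-strips are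
isomorphic; the kit's `DMono` has no such field, whence the restriction). ([IUTchI] Def 4.1 (iii) p.96)
[claim: Mochizuki2012, status: disputed] -/
abbrev DMonoOfFm : Type u' := Isomorphs (C := M.DMono) (modelFmStrip M FK).assocDm

/-- **IUTchI:Rmk5.2.1(i)** (kurims p.143) `𝔉^⊢ ↦ 𝔇^⊢` ("`𝒟^⊢`-prime-strips from `ℱ^⊢`-prime-strips") as a functor INTO the
`𝒟^⊢`-prime-strips of `ℱ`-type: abc-iut-L6-t7's `assocDmFunctor L`, every value being isomorphic to the model's
(any two `ℱ^⊢`-prime-strips are isomorphic, `iso_nonempty_FmStrip`). ([IUTchI] Rmk 5.2.1 (i) p.143)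
[claim: Mochizuki2012, status: disputed] -/
noncomputable def dMonoOfFmFunctor (L : FK.MonoLaws) : FK.FmStrip ⥤ DMonoOfFm FK :=
  Isomorphs.lift (PrimeStripGroupoids.assocDmFunctor L) fun F =>
    ⟨(PrimeStripGroupoids.assocDmFunctor L).mapIso
      (PrimeStripGroupoids.iso_nonempty_FmStrip F (modelFmStrip M FK)).some⟩

end DMono

/-! ### 3. The cross-kit passages (input) and the instance `TimesMuSide.ofPassages` -/

section OfPassages

variable {l : ℕ} {K : PMBaseKit.{max (v + 1) w} l} {M : K.MultKit} {FK : K.FKit M}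
  {P : PlaceData K.V} {G : K.V → Type} [∀ v, Group (G v)]
  {X : ∀ v, GroupTheoreticUnits.{0, w} (G v)}

/-- **IUTchII:Def4.9(vii)** (kurims p.158) The model `F^{⊢▶×μ}`-prime-strip `‡F^{⊢▶×μ}` of a model `F^{⊩▶×μ}`-prime-strip `‡F^{⊩▶×μ}`
(its `F^{⊢▶×μ}`-prime-strip, abc-iut-L6-t2's `toSplitStripFunctor`). ([IUTchII] Def 4.9 (vii) p.158) [claim: Mochizuki2012, status: disputed] -/
abbrev modelVt (S₀ : FVdashSplitTriMuPrimeStrip.{0, v, w} P G X) : FSplitTriMuPrimeStrip.{0, v, w} P G X :=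
  FVdashSplitTriMuPrimeStrip.toSplitStripFunctor.obj S₀

/-- **IUTchII:Def4.9(vii)** (kurims p.158) The model `F^{⊢×μ}`-prime-strip `‡F^{⊢×μ}` of `‡F^{⊩▶×μ}` (passing to `×μ`, abc-iut-L6-t2's
`toTimesMuFunctor`). ([IUTchII] Def 4.9 (vii) p.158) [claim: Mochizuki2012, status: disputed] -/
abbrev modelXm (S₀ : FVdashSplitTriMuPrimeStrip.{0, v, w} P G X) : FTimesMuPrimeStrip.{0, v, w} P G X :=
  FSplitTriMuPrimeStrip.toTimesMuFunctor.obj (modelVt S₀)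

variable (FK) in
/-- **IUTchII:Def4.9(vii)** (kurims p.158) INPUT — the CROSS-KIT PASSAGES, relative to a model `F^{⊩▶×μ}`-prime-strip `‡F^{⊩▶×μ}`
[Def 4.9 (viii) p.158] (whence the models `‡F^{⊢▶×μ}`, `‡F^{⊢×μ}` by forgetting / passing to `×μ`). Over abc-iut-L5-t4's kit
(`ℱ^⊢`-, `ℱ^⊩`-prime-strips in ABSTRACT ambient categories) and abc-iut-L6-t2's print-level records ([IUTchII] Def 4.9
(ii)–(viii)): the passage `F^⊢ ↦ F^{⊢×μ}` [Def 4.9 (vi)(vii) pp.157–158: the model `F^{⊢×μ}`-prime-strip `‡F^{⊢×μ}_v` formed from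
the split Frobenioid `‡ℱ^⊢_v`] and the passage `F^⊩ ↦ F^{⊩▶×μ}` [Def 4.9 (viii) p.158:
`‡F^{⊩▶×μ} = (‡𝒞^⊩, Prime(‡𝒞^⊩) ⥲ 𝕍, ‡F^{⊢▶×μ}, {‡ρ_v})` formed from `‡F^⊩`], each valued in strips isomorphic to the model
(print: "is isomorphic to `‡F^{⊢▶×μ}_v`"). No landed module constructs these functors (the kit's `FmAmb v` is abstract —
the `×μ`-Kummer data cannot be read off it); TODO-merge abc-iut-L6-t2 / abc-iut-L5. (The model is a PARAMETER so that
the universe `v` of abc-iut-L6-t2's monoids is read off its type.) ([IUTchII] Def 4.9 (vii) p.158) [claim: Mochizuki2012, status: disputed] -/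
structure TimesMuPassages (S₀ : FVdashSplitTriMuPrimeStrip.{0, v, w} P G X) where
  /-- `F^⊢ ↦ F^{⊢×μ}` [Def 4.9 (vi)(vii)] on the kit's `ℱ^⊢`-prime-strips -/
  timesMu : FK.FmStrip ⥤ FTimesMuPrimeStrip.{0, v, w} P G X
  /-- … valued in `F^{⊢×μ}`-prime-strips: "isomorphic to `‡F^{⊢×μ}`" -/
  timesMu_isModel : ∀ F : FK.FmStrip, Nonempty (timesMu.obj F ≅ modelXm S₀)
  /-- `F^⊩ ↦ F^{⊩▶×μ}` [Def 4.9 (viii)] on the kit's `ℱ^⊩`-prime-strips -/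
  vdash : FK.FrStrip ⥤ FVdashSplitTriMuPrimeStrip.{0, v, w} P G X
  /-- … valued in `F^{⊩▶×μ}`-prime-strips: "isomorphic to `‡F^{⊩▶×μ}`" -/
  vdash_isModel : ∀ F : FK.FrStrip, Nonempty (vdash.obj F ≅ S₀)

/-- **IUTchII:Def4.9(viii)** (kurims p.158) CONSISTENCY WITNESS ONLY: the CONSTANT passages at the model `F^{⊩▶×μ}`-prime-strip `S₀`
(every `ℱ^⊢`-prime-strip ↦ `S₀`'s `F^{⊢×μ}`-prime-strip, every `ℱ^⊩`-prime-strip ↦ `S₀`) satisfy the input's axioms — the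
fields of `TimesMuPassages` are jointly satisfiable as soon as abc-iut-L6-t2's `F^{⊩▶×μ}` record type is inhabited. NOT
the printed construction (which applies the `×μ`-Kummer / realification algorithms to the kit's local data).
([IUTchII] Def 4.9 (viii) p.158) [claim: Mochizuki2012, status: disputed] -/
def TimesMuPassages.const (S₀ : FVdashSplitTriMuPrimeStrip.{0, v, w} P G X) : TimesMuPassages FK S₀ where
  timesMu := (Functor.const _).obj (modelXm S₀)
  timesMu_isModel _ := ⟨Iso.refl _⟩
  vdash := (Functor.const _).obj S₀
  vdash_isModel _ := ⟨Iso.refl _⟩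

variable {S₀ : FVdashSplitTriMuPrimeStrip.{0, v, w} P G X}

/-- **IUTchII:Def4.9(vii)** (kurims p.158) **`TimesMuSide.ofPassages`** — the [IUTchII] Def 4.9 input of `StripFrame.ofKits`
INSTANTIATED (DESIGN NOTE W4D028-N2, product shape): `F^{⊢×μ}`-prime-strips := pairs (`𝒟^⊢`-prime-strip of
`ℱ`-type, isomorph of `‡F^{⊢×μ}` in abc-iut-L6-t2's groupoid `FTimesMuPrimeStrip`) [Def 4.9 (vii)]; `F^{⊢▶×μ}`- := pairs
(—, isomorph of `‡F^{⊢▶×μ}` in `FSplitTriMuPrimeStrip`) [Def 4.9 (vii), print-level split morphisms]; `F^{⊩▶×μ}`- := pairs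
(—, isomorph of `‡F^{⊩▶×μ}` in `FVdashSplitTriMuPrimeStrip`) [Def 4.9 (viii)]; `F^{⊢×μ} ↦ D^⊢` := first projection;
`F^{⊩▶×μ} ↦ F^{⊢▶×μ} ↦ F^{⊢×μ}` := abc-iut-L6-t2's `toSplitStripFunctor`, `toTimesMuFunctor` on the second component;
`F^⊢ ↦ F^{⊢×μ}` := (`𝔉^⊢ ↦ 𝔇^⊢`, the passage `Ps.timesMu`); `F^⊩ ↦ F^{⊩▶×μ}` := (`𝔉^⊩ ↦ 𝔉^⊢ ↦ 𝔇^⊢` under the Rmk 5.2.1 (ii)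
hypothesis `hR`, the passage `Ps.vdash`); the compatibility `F^⊢ → F^{⊢×μ} → D^⊢ = F^⊢ → D^⊢` holds ON THE NOSE;
connectedness PROVED (`Isomorphs.iso_nonempty`). ([IUTchII] Def 4.9 (vii) p.158) [claim: Mochizuki2012, status: disputed] -/
noncomputable def TimesMuSide.ofPassages (L : FK.MonoLaws) (hR : FK.RlfOfIsStrip)
    (Ps : TimesMuPassages FK S₀) : TimesMuSide FK L where
  Fxm := DMonoOfFm FK × Isomorphs (modelXm S₀)
  Fvtxm := DMonoOfFm FK × Isomorphs (modelVt S₀)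
  Fglxm := DMonoOfFm FK × Isomorphs S₀
  FvToFxm := (dMonoOfFmFunctor L).prod' (Isomorphs.lift Ps.timesMu Ps.timesMu_isModel)
  FxmToDv := CategoryTheory.Prod.fst _ _ ⋙ Isomorphs.ι _
  FglToFglxm :=
    (PrimeStripGroupoids.rlfFmFunctor FK (FKit.nonempty_rlfFm_rlfModel_iso_of_rlfOfIsStrip hR) ⋙
        dMonoOfFmFunctor L).prod' (Isomorphs.lift Ps.vdash Ps.vdash_isModel)
  FglxmToFvtxm := (𝟭 (DMonoOfFm FK)).prod (Isomorphs.mapAlong FVdashSplitTriMuPrimeStrip.toSplitStripFunctor)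
  FvtxmToFxm := (𝟭 (DMonoOfFm FK)).prod (Isomorphs.mapAlong FSplitTriMuPrimeStrip.toTimesMuFunctor)
  fxm_comm := Iso.refl _
  iso_nonempty_Fxm A B :=
    ⟨Iso.prod (Isomorphs.iso_nonempty A.1 B.1).some (Isomorphs.iso_nonempty A.2 B.2).some⟩
  iso_nonempty_Fglxm A B :=
    ⟨Iso.prod (Isomorphs.iso_nonempty A.1 B.1).some (Isomorphs.iso_nonempty A.2 B.2).some⟩

variable (L : FK.MonoLaws) (hbij : FK.IsomFtoDBijective) (hsurj : FK.IsomFmtoDmSurjective)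
  (hR : FK.RlfOfIsStrip) (Ps : TimesMuPassages FK S₀)

/-- **IUTchII:Def4.9(vii)** (kurims p.158) In the instance, `F^{⊢×μ} ↦ D^⊢` of an `F^{⊢×μ}`-prime-strip is its recorded
`𝒟^⊢`-prime-strip (first projection). ([IUTchII] Def 4.9 (vii) p.158) [claim: Mochizuki2012, status: disputed] -/
theorem TimesMuSide.ofPassages_fxmToDv_obj (A : (TimesMuSide.ofPassages L hR Ps).Fxm) :
    (TimesMuSide.ofPassages L hR Ps).FxmToDv.obj A = A.1.obj := rfl

/-- **IUTchII:Def4.9(vii)** (kurims p.158) In the instance, `F^⊢ → F^{⊢×μ} → D^⊢` IS `𝔉^⊢ ↦ 𝔇^⊢` on objects (abc-iut-L5-t4's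
`FmStrip.assocDm`), on the nose. ([IUTchII] Def 4.9 (vii) p.158) [claim: Mochizuki2012, status: disputed] -/
theorem TimesMuSide.ofPassages_fvToFxm_fxmToDv_obj (F : FK.FmStrip) :
    (TimesMuSide.ofPassages L hR Ps).FxmToDv.obj ((TimesMuSide.ofPassages L hR Ps).FvToFxm.obj F) =
      F.assocDm := rfl

/-! ### 4. Consequences on the real frame: the residual `R` and its corollaries WITHOUT hypothesis on the [IUTchII] side -/

/-- **IUTchII:Cor4.10(iv)** (kurims p.160) KEY: in the instance the composite `F^{⊩▶×μ} ↦ F^{⊢▶×μ} ↦ F^{⊢×μ}` is SURJECTIVE on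
`Isom(A, B)` for all `A`, `B` — the one hypothesis of abc-iut-w4-d028's `StripFrameOfKitsFullness` — PROVED from
abc-iut-w4-d028's print-level lift `FVdashSplitTriMuPrimeStrip.mapIso_toTimesMu_surjective_of_iso` (the `×μ`-part
lifts with identity `O^▶`-part and identity realified data; [IUTchII] Def 4.9 (iii)/(iv) `O^{▶×μ} = O^▶ × O^{×μ}`) and
the identity on the `𝒟^⊢`-component. ([IUTchII] Cor 4.10 (iv) p.160) [claim: Mochizuki2012, status: disputed] -/
theorem TimesMuSide.ofPassages_mapIso_surjective (A B : (TimesMuSide.ofPassages L hR Ps).Fglxm) :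
    Function.Surjective (fun g : A ≅ B =>
      ((TimesMuSide.ofPassages L hR Ps).FglxmToFvtxm ⋙ (TimesMuSide.ofPassages L hR Ps).FvtxmToFxm).mapIso g) := by
  intro φ
  -- the two components of the target isomorphism
  let φ₁ := (CategoryTheory.Prod.fst _ _).mapIso φ
  let φ₂ := (CategoryTheory.Prod.snd _ _).mapIso φ
  -- lift the `×μ`-component through abc-iut-L6-t2's groupoids (abc-iut-w4-d028's print-level lift)
  obtain ⟨e⟩ := Isomorphs.iso_nonempty A.2 B.2
  obtain ⟨g₂, hg₂⟩ :=
    FVdashSplitTriMuPrimeStrip.mapIso_toTimesMu_surjective_of_iso ((Isomorphs.isoEquiv _ _) e)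
      ((Isomorphs.isoEquiv _ _) φ₂)
  exact ⟨Iso.prod (φ₁ : A.1 ≅ B.1) (Isomorphs.isoMk g₂ : A.2 ≅ B.2),
    Iso.ext (CategoryTheory.Prod.hom_ext rfl (congrArg Iso.hom hg₂))⟩

/-- **IUTchII:Cor4.10(iv)** (kurims p.160) "one obtains a poly-isomorphism `†F^{⊢×μ}_△ ⥲ ‡F^{⊢×μ}_△` which coincides with the full
poly-isomorphism" — the frame-level residual `R` of `UnitMuCoricFrame` HOLDS on the real frame over the print-level
groupoids, with NO hypothesis on the [IUTchII] side. ([IUTchII] Cor 4.10 (iv) p.160) [claim: Mochizuki2012, status: disputed] -/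
theorem StripFrame.ofPassages_map_full_fglxmToFxm
    (A B : (StripFrame.ofKits L hbij hsurj hR (TimesMuSide.ofPassages L hR Ps)).Fglxm) :
    (PolyIso.full A B).map (StripFrame.ofKits L hbij hsurj hR (TimesMuSide.ofPassages L hR Ps)).FglxmToFxm =
      PolyIso.full _ _ :=
  StripFrame.ofKits_map_full_fglxmToFxm L hbij hsurj hR _
    (TimesMuSide.ofPassages_mapIso_surjective L hR Ps) A B

/-- **IUTchII:Cor4.10(iv)** (kurims p.160) "`(−)F^{⊢×μ}_△` is an invariant of both the `Θ^{×μ}`- and `Θ^{×μ}_{gau}`-links":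
abc-iut-L6-t2's named statement `HodgeTheaterStrips.UnitMuCoric` (FACT-LIST F-2065) for EVERY pair of Hodge-theater
strips over the setting induced by the real frame over the print-level groupoids — no hypothesis on the [IUTchII]
side. ([IUTchII] Cor 4.10 (iv) p.160) [claim: Mochizuki2012, status: disputed] -/
theorem StripFrame.ofPassages_unitMuCoric
    (dag ddag : HodgeTheaterStrips
      (ThetaLinkSetting.ofStripFrame (StripFrame.ofKits L hbij hsurj hR (TimesMuSide.ofPassages L hR Ps)))) :
    dag.UnitMuCoric ddag :=
  StripFrame.ofKits_unitMuCoric L hbij hsurj hR _ (TimesMuSide.ofPassages_mapIso_surjective L hR Ps) dag ddag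

/-- **IUTchIII:Thm2.2(i)** (kurims p.65) "the second arrows in each line are surjections" — the field shape
`ThetaMonoidData.mapAut_surjective` — for every `F^{⊩▶×μ}`-prime-strip of the real frame over the print-level
groupoids, no hypothesis on the [IUTchII] side. ([IUTchIII] Thm 2.2 (i) p.65) [claim: Mochizuki2012, status: disputed] -/
theorem StripFrame.ofPassages_mapAut_surjective
    (A : (StripFrame.ofKits L hbij hsurj hR (TimesMuSide.ofPassages L hR Ps)).Fglxm) :
    Function.Surjective
      ((StripFrame.ofKits L hbij hsurj hR (TimesMuSide.ofPassages L hR Ps)).FglxmToFxm.mapAut A) :=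
  StripFrame.ofKits_mapAut_surjective L hbij hsurj hR _ (TimesMuSide.ofPassages_mapIso_surjective L hR Ps) A

/-- **IUTchIII:Thm1.5(ii)** (kurims p.48) "The horizontal arrows of the Gaussian log-theta-lattice induce full
poly-isomorphisms between the respective associated `F^{⊢×μ}`-prime-strips" — the field shape
`ThetaLinkData.induced_full` for ANY pair of pilot functors on the real frame over the print-level groupoids, no
hypothesis on the [IUTchII] side. ([IUTchIII] Thm 1.5 (ii) p.48) [claim: Mochizuki2012, status: disputed] -/
theorem StripFrame.ofPassages_induced_full
    (Pd Pt : (StripFrame.ofKits L hbij hsurj hR (TimesMuSide.ofPassages L hR Ps)).HT ⥤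
      (StripFrame.ofKits L hbij hsurj hR (TimesMuSide.ofPassages L hR Ps)).Fglxm)
    (Y Z : (StripFrame.ofKits L hbij hsurj hR (TimesMuSide.ofPassages L hR Ps)).HT) :
    (PolyIso.full (Pd.obj Y) (Pt.obj Z)).map
        (StripFrame.ofKits L hbij hsurj hR (TimesMuSide.ofPassages L hR Ps)).FglxmToFxm = PolyIso.full _ _ :=
  StripFrame.ofKits_induced_full L hbij hsurj hR _ (TimesMuSide.ofPassages_mapIso_surjective L hR Ps) Pd Pt Y Z

/-- **IUTchIII:Thm1.5(ii)** (kurims p.48) NON-VACUITY: over the real frame over the print-level groupoids, this seat's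
[IUTchIII] Thm 1.5 (ii) interface `ThetaLinkData` is INHABITED with ANY prescribed pilot functors
`†ℋ𝒯 ↦ †F^{⊩▶×μ}_△`, `†ℋ𝒯 ↦ †F^{⊩▶×μ}_{env/gau}` and unit-portion isomorphisms ([IUTchII] Cor 4.10 (i)–(iii)), its axiom
`induced_full` a theorem (abc-iut-w4-d028 / abc-iut-w4-d018). ([IUTchIII] Thm 1.5 (ii) p.48) [claim: Mochizuki2012, status: disputed] -/
theorem StripFrame.ofPassages_exists_thetaLinkData
    (pilotDelta : (StripFrame.ofKits L hbij hsurj hR (TimesMuSide.ofPassages L hR Ps)).HT ⥤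
      (StripFrame.ofKits L hbij hsurj hR (TimesMuSide.ofPassages L hR Ps)).Fglxm)
    (pilotTheta : LatticeKind →
      ((StripFrame.ofKits L hbij hsurj hR (TimesMuSide.ofPassages L hR Ps)).HT ⥤
        (StripFrame.ofKits L hbij hsurj hR (TimesMuSide.ofPassages L hR Ps)).Fglxm))
    (unitPortion : ∀ k : LatticeKind,
      pilotDelta ⋙ (StripFrame.ofKits L hbij hsurj hR (TimesMuSide.ofPassages L hR Ps)).FglxmToFxm ≅
        pilotTheta k ⋙ (StripFrame.ofKits L hbij hsurj hR (TimesMuSide.ofPassages L hR Ps)).FglxmToFxm) :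
    ∃ T : ThetaLinkData (StripFrame.ofKits L hbij hsurj hR (TimesMuSide.ofPassages L hR Ps)),
      T.pilotDelta = pilotDelta ∧ T.pilotTheta = pilotTheta ∧
        T.fxmDelta = pilotDelta ⋙
          (StripFrame.ofKits L hbij hsurj hR (TimesMuSide.ofPassages L hR Ps)).FglxmToFxm :=
  StripFrame.ofKits_exists_thetaLinkData L hbij hsurj hR _ (TimesMuSide.ofPassages_mapIso_surjective L hR Ps)
    pilotDelta pilotTheta unitPortion

/-! ### 5. Non-vacuity of the input -/

/-- **IUTchII:Def4.9(viii)** (kurims p.158) The [IUTchII] Def 4.9 input `TimesMuSide FK L` of the real frame is INHABITED over every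
kit (with abc-iut-L5-d4's laws and the [IUTchI] Rmk 5.2.1 (ii) hypothesis `RlfOfIsStrip`) as soon as abc-iut-L6-t2's
print-level `F^{⊩▶×μ}` record type over `(P, G, X)` is — via the constant passages (consistency witness
`TimesMuPassages.const`). ([IUTchII] Def 4.9 (viii) p.158) [claim: Mochizuki2012, status: disputed] -/
theorem nonempty_timesMuSide_of_nonempty (L : FK.MonoLaws) (hR : FK.RlfOfIsStrip)
    (h : Nonempty (FVdashSplitTriMuPrimeStrip.{0, v, w} P G X)) :
    Nonempty (TimesMuSide FK L) :=
  ⟨TimesMuSide.ofPassages L hR (TimesMuPassages.const (FK := FK) h.some)⟩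

end OfPassages

end Literature.IUT.LogThetaLattice
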